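import Summits.NavierStokesRegularity.FunctionalMining.StretchingWrapIdentityHolds
import HarnessLib

/-!
# K1-Q1, the wrap blueprint: node N4 `PlateauEnvelope` (plateau envelopes of the two strain boxes)

Cell `pub-nsfunc` (host summit NavierStokesRegularity, topic `FunctionalMining`), prove seat gen 5, kernel proof of
node **N4 `PlateauEnvelope`** of the bank seat's `WRAP-KERNEL-BLUEPRINT.md` §4, as typed by the dictionary seat in
`StretchingWrapIdentity.lean`. **Search for candidate a priori estimates; no regularity claim.** Static facts about
smooth functions on the torus only; nothing is asserted about Navier–Stokes.

Construction (exact plateaus, no `sin`): with `ε = δ/2` and the tree's slope wave `w_ε`, the bump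
`η(t) = ¼(1 − w_ε(t + ¼ − 2δ))(1 − w_ε(t + ¼ + 3δ))` is smooth, `1`-periodic, takes values in `[0,1]`, vanishes
unless `fract t ∈ (2δ, ½ − 2δ)` and equals `1` for `fract t ∈ [3δ, ½ − 3δ]`; hence
`½ − 6δ ≤ ∫₀¹η³ ≤ ∫₀¹η² ≤ ½ − 4δ`. The envelopes `E₊(x) = η(x₁+x₂)η(x₁−x₂)` and
`E₋(x) = η(x₁+x₂+½)η(x₁−x₂+½)` are smooth, `[0,1]`-valued, vanish off `boxPlus 2δ` / `boxMinus 2δ`, and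
`∫E^p = (∫₀¹η^p)²` by Lemma D (`integral_mul_add_sub`). Headline: `plateauEnvelope_holds : PlateauEnvelope`.
-/

noncomputable section

open MeasureTheory Set Filter Topology Function
open scoped InnerProductSpace ContDiff

namespace Summit.NavierStokesRegularity.FunctionalMining

open Literature.Analysis Literature.Analysis.FunctionSpaces Literature.Analysis.FunctionSpaces.Torus
open Literature.Analysis.FluidPDE Literature.Analysis.FluidPDE.Torus

namespace WrapStretching

open CellularStretching

/-! ## 1. The bump `η` -/

section Bump

variable {δ : ℝ} (hδ : 0 < δ) (hδ' : δ < 1 / 16)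

/-- `δ/2` is an admissible transition parameter. [folklore] -/
theorem half_delta_pos (hδ : 0 < δ) : 0 < δ / 2 := by linarith

/-- `δ/2 ≤ 1/32` for `δ < 1/16`. [folklore] -/
theorem half_delta_le (hδ' : δ < 1 / 16) : δ / 2 ≤ 1 / 32 := by linarith

/-- **The bump** `η(t) = ¼(1 − w_{δ/2}(t + ¼ − 2δ))(1 − w_{δ/2}(t + ¼ + 3δ))`. [ours] -/
def bump (hδ : 0 < δ) (hδ' : δ < 1 / 16) : ShearProfile where
  toFun t := (1 - DEIJ.slopeWave (δ / 2) (t + (4⁻¹ - 2 * δ))) / 2 *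
    ((1 - DEIJ.slopeWave (δ / 2) (t + (4⁻¹ + 3 * δ))) / 2)
  periodic' t := by
    show (1 - DEIJ.slopeWave (δ / 2) (t + 1 + (4⁻¹ - 2 * δ))) / 2 *
        ((1 - DEIJ.slopeWave (δ / 2) (t + 1 + (4⁻¹ + 3 * δ))) / 2) =
      (1 - DEIJ.slopeWave (δ / 2) (t + (4⁻¹ - 2 * δ))) / 2 *
        ((1 - DEIJ.slopeWave (δ / 2) (t + (4⁻¹ + 3 * δ))) / 2)
    rw [show t + 1 + (4⁻¹ - 2 * δ) = (t + (4⁻¹ - 2 * δ)) + 1 by ring,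
      show t + 1 + (4⁻¹ + 3 * δ) = (t + (4⁻¹ + 3 * δ)) + 1 by ring,
      DEIJ.slopeWave_periodic, DEIJ.slopeWave_periodic]
  contDiff' := by
    have hq := DEIJ.contDiff_slopeWave (half_delta_pos hδ) (le_sixteenth (half_delta_le hδ'))
    exact ((contDiff_const.sub (hq.comp (contDiff_id.add contDiff_const))).div_const _).mul
      ((contDiff_const.sub (hq.comp (contDiff_id.add contDiff_const))).div_const _)

/-- Values of the bump. [ours; bookkeeping] -/
theorem bump_apply (t : ℝ) : bump hδ hδ' t = (1 - DEIJ.slopeWave (δ / 2) (t + (4⁻¹ - 2 * δ))) / 2 *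
    ((1 - DEIJ.slopeWave (δ / 2) (t + (4⁻¹ + 3 * δ))) / 2) := rfl

/-- `0 ≤ η ≤ 1`. [ours; elementary] -/
theorem bump_mem (t : ℝ) : bump hδ hδ' t ∈ Icc (0 : ℝ) 1 := by
  rw [bump_apply]
  have h16 := le_sixteenth (half_delta_le hδ')
  have h1 := abs_le.1 (DEIJ.abs_slopeWave_le (half_delta_pos hδ) h16 (t + (4⁻¹ - 2 * δ)))
  have h2 := abs_le.1 (DEIJ.abs_slopeWave_le (half_delta_pos hδ) h16 (t + (4⁻¹ + 3 * δ)))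
  constructor
  · exact mul_nonneg (by linarith) (by linarith)
  · nlinarith

/-- **Support of the bump**: `η(t) = 0` unless `fract t ∈ (2δ, ½ − 2δ)`. [ours; elementary] -/
theorem bump_eq_zero {t : ℝ} (ht : Int.fract t ≤ 2 * δ ∨ 1 / 2 - 2 * δ ≤ Int.fract t) : bump hδ hδ' t = 0 := by
  have hε := half_delta_pos hδ
  have h16 := le_sixteenth (half_delta_le hδ')
  have hf0 : 0 ≤ Int.fract t := Int.fract_nonneg t
  have hf1 : Int.fract t < 1 := Int.fract_lt_one t
  have htf : t = ⌊t⌋ + Int.fract t := (Int.floor_add_fract t).symm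
  rw [bump_apply]
  rcases ht with h | h
  · -- first factor vanishes
    have h1 : DEIJ.slopeWave (δ / 2) (t + (4⁻¹ - 2 * δ)) = 1 :=
      slopeWave_eq_one hε h16 ⌊t⌋ ⟨by linarith, by linarith⟩
    rw [h1]; ring
  · rcases le_or_gt (Int.fract t) (1 - 3 * δ) with h' | h'
    · -- second factor vanishes
      have h1 : DEIJ.slopeWave (δ / 2) (t + (4⁻¹ + 3 * δ)) = 1 :=
        slopeWave_eq_one hε h16 (⌊t⌋ + 1) ⟨by push_cast; linarith, by push_cast; linarith⟩
      rw [h1]; ring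
    · -- first factor vanishes (wrap-around)
      have h1 : DEIJ.slopeWave (δ / 2) (t + (4⁻¹ - 2 * δ)) = 1 :=
        slopeWave_eq_one hε h16 (⌊t⌋ + 1) ⟨by push_cast; linarith, by push_cast; linarith⟩
      rw [h1]; ring

/-- **Plateau of the bump**: `η(t) = 1` for `fract t ∈ [3δ, ½ − 3δ]`. [ours; elementary] -/
theorem bump_eq_one {t : ℝ} (h1 : 3 * δ ≤ Int.fract t) (h2 : Int.fract t ≤ 1 / 2 - 3 * δ) : bump hδ hδ' t = 1 := by
  have hε := half_delta_pos hδ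
  have htf : t = ⌊t⌋ + Int.fract t := (Int.floor_add_fract t).symm
  have ha : DEIJ.slopeWave (δ / 2) (t + (4⁻¹ - 2 * δ)) = -1 :=
    slopeWave_eq_neg_one hε ⌊t⌋ ⟨by linarith, by linarith⟩
  have hb : DEIJ.slopeWave (δ / 2) (t + (4⁻¹ + 3 * δ)) = -1 :=
    slopeWave_eq_neg_one hε ⌊t⌋ ⟨by linarith, by linarith⟩
  rw [bump_apply, ha, hb]; norm_num

/-- Where the bump does not vanish, `fract ∈ (2δ, ½ − 2δ)`. [ours; elementary] -/
theorem fract_mem_of_bump_ne_zero {t : ℝ} (h : bump hδ hδ' t ≠ 0) :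
    2 * δ < Int.fract t ∧ Int.fract t < 1 / 2 - 2 * δ := by
  by_contra hc
  rw [not_and_or, not_lt, not_lt] at hc
  exact h (bump_eq_zero hδ hδ' hc)

/-- `↑(fract s) = ↑s` in `T = ℝ/ℤ`. [folklore] -/
theorem coe_fract (s : ℝ) : ((Int.fract s : ℝ) : UnitAddCircle) = (s : UnitAddCircle) := by
  rw [Int.fract, AddCircle.coe_sub]
  have : ((⌊s⌋ : ℝ) : UnitAddCircle) = 0 := by
    rw [AddCircle.coe_eq_zero_iff]
    exact ⟨⌊s⌋, by simp⟩
  rw [this, sub_zero]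

/-- **On the circle: the bump lives on the arc `inArc 2δ`.** [ours; elementary] -/
theorem inArc_of_bump_onCircle_ne_zero {y : UnitAddCircle} (h : (bump hδ hδ').onCircle y ≠ 0) :
    inArc (2 * δ) y := by
  obtain ⟨s, rfl⟩ := QuotientAddGroup.mk_surjective y
  rw [ShearProfile.onCircle_coe] at h
  obtain ⟨h1, h2⟩ := fract_mem_of_bump_ne_zero hδ hδ' h
  exact ⟨Int.fract s, ⟨h1.le, h2.le⟩, coe_fract s⟩

/-- The bump vanishes on `[0, 2δ]` and on `[½ − 2δ, 1]` (real form, for the period integral). [ours; elementary] -/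
theorem bump_eq_zero_of_mem {t : ℝ} (ht : t ∈ Icc (0 : ℝ) (2 * δ) ∨ t ∈ Icc (1 / 2 - 2 * δ) 1) :
    bump hδ hδ' t = 0 := by
  rcases ht with h | h
  · have hf : Int.fract t = t := Int.fract_eq_self.2 ⟨h.1, by linarith [h.2]⟩
    exact bump_eq_zero hδ hδ' (Or.inl (by rw [hf]; exact h.2))
  · rcases eq_or_lt_of_le h.2 with h1 | h1
    · rw [h1]
      exact bump_eq_zero hδ hδ' (Or.inl (by rw [Int.fract_one]; linarith))
    · have hf : Int.fract t = t := Int.fract_eq_self.2 ⟨by linarith [h.1], h1⟩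
      exact bump_eq_zero hδ hδ' (Or.inr (by rw [hf]; exact h.1))

/-- **Period integrals of powers of the bump**: `½ − 6δ ≤ ∫₀¹ ηᵖ ≤ ½ − 4δ` (`p ≥ 1`). [ours] -/
theorem intervalIntegral_bump_pow_mem (p : ℕ) (hp : 1 ≤ p) :
    ∫ t in (0 : ℝ)..1, bump hδ hδ' t ^ p ∈ Icc (1 / 2 - 6 * δ) (1 / 2 - 4 * δ) := by
  have hcont : Continuous fun t => bump hδ hδ' t ^ p := (bump hδ hδ').continuous.pow p
  have hi : ∀ a b : ℝ, IntervalIntegrable (fun t => bump hδ hδ' t ^ p) volume a b := fun a b =>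
    hcont.intervalIntegrable a b
  have hpw : ∀ t, bump hδ hδ' t ^ p ∈ Icc (0 : ℝ) 1 := fun t =>
    ⟨pow_nonneg (bump_mem hδ hδ' t).1 p, pow_le_one₀ (bump_mem hδ hδ' t).1 (bump_mem hδ hδ' t).2⟩
  constructor
  · -- plateau
    have h1 : ∫ t in (3 * δ)..(1 / 2 - 3 * δ), bump hδ hδ' t ^ p = 1 / 2 - 6 * δ := by
      have : ∫ t in (3 * δ)..(1 / 2 - 3 * δ), bump hδ hδ' t ^ p = ∫ _t in (3 * δ)..(1 / 2 - 3 * δ), (1 : ℝ) := by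
        refine intervalIntegral.integral_congr fun t ht => ?_
        rw [uIcc_of_le (by linarith)] at ht
        have hf : Int.fract t = t := Int.fract_eq_self.2 ⟨by linarith [ht.1], by linarith [ht.2]⟩
        rw [bump_eq_one hδ hδ' (by rw [hf]; exact ht.1) (by rw [hf]; exact ht.2), one_pow]
      rw [this, intervalIntegral.integral_const, smul_eq_mul, mul_one]; ring
    have h2 : ∫ t in (3 * δ)..(1 / 2 - 3 * δ), bump hδ hδ' t ^ p ≤ ∫ t in (0 : ℝ)..1, bump hδ hδ' t ^ p :=
      intervalIntegral.integral_mono_interval (by linarith) (by linarith) (by linarith)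
        (Filter.Eventually.of_forall fun t => (hpw t).1) (hi 0 1)
    linarith
  · -- support
    have hsplit : ∫ t in (0 : ℝ)..1, bump hδ hδ' t ^ p =
        (∫ t in (0 : ℝ)..(2 * δ), bump hδ hδ' t ^ p) + ((∫ t in (2 * δ)..(1 / 2 - 2 * δ), bump hδ hδ' t ^ p) +
          ∫ t in (1 / 2 - 2 * δ)..1, bump hδ hδ' t ^ p) := by
      rw [intervalIntegral.integral_add_adjacent_intervals (hi _ _) (hi _ _),
        intervalIntegral.integral_add_adjacent_intervals (hi _ _) (hi _ _)]
    have hz1 : ∫ t in (0 : ℝ)..(2 * δ), bump hδ hδ' t ^ p = 0 := by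
      have : ∫ t in (0 : ℝ)..(2 * δ), bump hδ hδ' t ^ p = ∫ _t in (0 : ℝ)..(2 * δ), (0 : ℝ) := by
        refine intervalIntegral.integral_congr fun t ht => ?_
        rw [uIcc_of_le (by linarith)] at ht
        rw [bump_eq_zero_of_mem hδ hδ' (Or.inl ht), zero_pow (by omega)]
      rw [this, intervalIntegral.integral_const, smul_eq_mul, mul_zero]
    have hz2 : ∫ t in (1 / 2 - 2 * δ)..1, bump hδ hδ' t ^ p = 0 := by
      have : ∫ t in (1 / 2 - 2 * δ)..1, bump hδ hδ' t ^ p = ∫ _t in (1 / 2 - 2 * δ)..1, (0 : ℝ) := by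
        refine intervalIntegral.integral_congr fun t ht => ?_
        rw [uIcc_of_le (by linarith)] at ht
        rw [bump_eq_zero_of_mem hδ hδ' (Or.inr ht), zero_pow (by omega)]
      rw [this, intervalIntegral.integral_const, smul_eq_mul, mul_zero]
    have hmid : ∫ t in (2 * δ)..(1 / 2 - 2 * δ), bump hδ hδ' t ^ p ≤ ∫ _t in (2 * δ)..(1 / 2 - 2 * δ), (1 : ℝ) :=
      intervalIntegral.integral_mono_on (by linarith) (hi _ _) intervalIntegrable_const fun t _ => (hpw t).2
    rw [intervalIntegral.integral_const, smul_eq_mul, mul_one] at hmid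
    rw [hsplit, hz1, hz2]
    linarith

/-- `∫₀¹ η³ ≤ ∫₀¹ η²`. [ours; elementary] -/
theorem intervalIntegral_bump_cube_le_sq :
    ∫ t in (0 : ℝ)..1, bump hδ hδ' t ^ 3 ≤ ∫ t in (0 : ℝ)..1, bump hδ hδ' t ^ 2 :=
  intervalIntegral.integral_mono_on zero_le_one (((bump hδ hδ').continuous.pow 3).intervalIntegrable 0 1)
    (((bump hδ hδ').continuous.pow 2).intervalIntegrable 0 1) fun t _ => by
      have h := bump_mem hδ hδ' t
      nlinarith [h.1, h.2, sq_nonneg (bump hδ hδ' t)]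

end Bump

/-! ## 2. Shifted profiles on the circle and period integrals of powers -/

/-- `(shift P c).onCircle y = P.onCircle (y + ↑c)`. [folklore] -/
theorem onCircle_shift (P : ShearProfile) (c : ℝ) (y : UnitAddCircle) :
    (shift P c).onCircle y = P.onCircle (y + (c : UnitAddCircle)) := by
  obtain ⟨t, rfl⟩ := QuotientAddGroup.mk_surjective y
  rw [ShearProfile.onCircle_coe, ← AddCircle.coe_add, ShearProfile.onCircle_coe, shift_apply]

/-- Period integrals of powers are shift invariant. [folklore] -/
theorem intervalIntegral_pow_shift (P : ShearProfile) (c : ℝ) (p : ℕ) :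
    ∫ t in (0 : ℝ)..1, shift P c t ^ p = ∫ t in (0 : ℝ)..1, P t ^ p := by
  simp only [shift_apply]
  rw [intervalIntegral.integral_comp_add_right (fun t => P t ^ p) c, zero_add]
  have hper : Function.Periodic (fun t => P t ^ p) 1 := fun t => by simp [P.periodic t]
  have := hper.intervalIntegral_add_eq c 0
  rw [zero_add] at this
  rw [show (1 : ℝ) + c = c + 1 by ring, this]

/-- `∫_T (P.onCircle b)ᵖ db = ∫₀¹ Pᵖ`. [folklore] -/
theorem integral_pow_onCircle (P : ShearProfile) (p : ℕ) :
    ∫ b, P.onCircle b ^ p = ∫ t in (0 : ℝ)..1, P t ^ p := by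
  rw [integral_circle_eq_intervalIntegral]; simp

/-! ## 3. The envelopes `E± = η(x₁+x₂ [+½])·η(x₁−x₂ [+½])` and `PlateauEnvelope` -/

/-- **The envelope of a profile**: `E_P(x) = P(x₁+x₂)·P(x₁−x₂)`. [ours] -/
def env (P : ShearProfile) (x : UnitAddTorus (Fin 3)) : ℝ := P.onCircle (x 1 + x 2) * P.onCircle (x 1 - x 2)

/-- `E_P` is smooth. [ours; elementary] -/
theorem isSmooth_env (P : ShearProfile) : IsSmooth (env P) := by
  have h : env P = fun x => diagForm 1 1 P x * diagForm 1 (-1) P x := by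
    funext x; simp [env]
  rw [h]
  exact (isSmooth_diagForm 1 1 P).mul (isSmooth_diagForm 1 (-1) P)

/-- **`∫ E_Pᵖ = (∫₀¹ Pᵖ)²`** (Lemma D). [ours; elementary] -/
theorem integral_env_pow (P : ShearProfile) (p : ℕ) :
    ∫ x, env P x ^ p = (∫ t in (0 : ℝ)..1, P t ^ p) ^ 2 := by
  have hc : Continuous fun c : UnitAddCircle => P.onCircle c ^ p := P.continuous_onCircle.pow p
  have h : ∫ x : UnitAddTorus (Fin 3), env P x ^ p =
      ∫ y : UnitAddTorus (Fin 2), P.onCircle (y 0 + y 1) ^ p * P.onCircle (y 0 - y 1) ^ p := by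
    have := integral_comp_tailProj
      (F := fun y : UnitAddTorus (Fin 2) => P.onCircle (y 0 + y 1) ^ p * P.onCircle (y 0 - y 1) ^ p)
      (((continuous_onCircle_add P).pow p).mul ((continuous_onCircle_sub P).pow p)).aestronglyMeasurable
    rw [← this]
    refine integral_congr_ae (ae_of_all _ fun x => ?_)
    simp only [env, mul_pow]
    rfl
  rw [h, integral_mul_add_sub (a := fun c => P.onCircle c ^ p) (b := fun c => P.onCircle c ^ p) hc hc,
    integral_pow_onCircle, sq]

section Envelopes

variable {δ : ℝ} (hδ : 0 < δ) (hδ' : δ < 1 / 16)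

/-- `E₊ ∈ [0,1]`. [ours; elementary] -/
theorem env_mem (P : ShearProfile) (hP : ∀ t, P t ∈ Icc (0 : ℝ) 1) (x : UnitAddTorus (Fin 3)) :
    0 ≤ env P x ∧ env P x ≤ 1 := by
  have h1 := onCircle_mem hP (x 1 + x 2)
  have h2 := onCircle_mem hP (x 1 - x 2)
  exact ⟨mul_nonneg h1.1 h2.1, mul_le_one₀ h1.2 h2.1 h2.2⟩

/-- **`E₊ = env η` vanishes off `boxPlus 2δ`.** [ours] -/
theorem env_bump_eq_zero {x : UnitAddTorus (Fin 3)} (hx : x ∉ boxPlus (2 * δ)) : env (bump hδ hδ') x = 0 := by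
  by_contra h
  rcases mul_ne_zero_iff.1 h with ⟨h1, h2⟩
  exact hx ⟨inArc_of_bump_onCircle_ne_zero hδ hδ' h1, inArc_of_bump_onCircle_ne_zero hδ hδ' h2⟩

/-- **`E₋ = env (η(· + ½))` vanishes off `boxMinus 2δ`.** [ours] -/
theorem env_bumpShift_eq_zero {x : UnitAddTorus (Fin 3)} (hx : x ∉ boxMinus (2 * δ)) :
    env (shift (bump hδ hδ') (1 / 2)) x = 0 := by
  by_contra h
  rcases mul_ne_zero_iff.1 h with ⟨h1, h2⟩
  rw [onCircle_shift] at h1 h2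
  exact hx ⟨inArc_of_bump_onCircle_ne_zero hδ hδ' h1, inArc_of_bump_onCircle_ne_zero hδ hδ' h2⟩

/-- The shifted bump takes values in `[0,1]`. [ours; elementary] -/
theorem bumpShift_mem (t : ℝ) : shift (bump hδ hδ') (1 / 2) t ∈ Icc (0 : ℝ) 1 := bump_mem hδ hδ' (t + 1 / 2)

/-- **The integral sandwich for an envelope of a `[0,1]`-profile with `½ − 6δ ≤ ∫P³`, `∫P² ≤ ½ − 4δ`, `∫P³ ≤ ∫P²`.**
[ours; elementary] -/
theorem env_integral_sandwich (P : ShearProfile) (h3 : 1 / 2 - 6 * δ ≤ ∫ t in (0 : ℝ)..1, P t ^ 3)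
    (h32 : ∫ t in (0 : ℝ)..1, P t ^ 3 ≤ ∫ t in (0 : ℝ)..1, P t ^ 2) (h2 : ∫ t in (0 : ℝ)..1, P t ^ 2 ≤ 1 / 2 - 4 * δ)
    (hδ' : δ < 1 / 16) :
    (1 / 2 - 6 * δ) ^ 2 ≤ ∫ x, env P x ^ 3 ∧ (∫ x, env P x ^ 3) ≤ ∫ x, env P x ^ 2 ∧
      (∫ x, env P x ^ 2) ≤ (1 / 2 - 4 * δ) ^ 2 := by
  rw [integral_env_pow, integral_env_pow]
  have h0 : 0 ≤ 1 / 2 - 6 * δ := by linarith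
  have hI3 : 0 ≤ ∫ t in (0 : ℝ)..1, P t ^ 3 := h0.trans h3
  refine ⟨pow_le_pow_left₀ h0 h3 2, pow_le_pow_left₀ hI3 h32 2, pow_le_pow_left₀ (hI3.trans h32) h2 2⟩

end Envelopes

/-- **N4 of the bank's wrap blueprint holds: `PlateauEnvelope`** (dictionary seat's typed node in
`StretchingWrapIdentity.lean`): for every `δ ∈ (0, 1/16)` there are smooth `[0,1]`-valued envelopes `E₊`, `E₋`
vanishing off `boxPlus 2δ`, `boxMinus 2δ`, with `(½ − 6δ)² ≤ ∫E³ ≤ ∫E² ≤ (½ − 4δ)²` — the products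
`η(x₁+x₂)η(x₁−x₂)` (resp. shifted by `½`) of the exact-plateau bump `η`. With `wrapIdentityBound_holds` (N1) the
remaining kernel obligations of the blueprint are N2 (`ConfinementLemma`) and N3± (`PlanarFillerFamilyPot±`).
Search for candidate a priori estimates; no regularity claim. [ours] -/
theorem plateauEnvelope_holds : PlateauEnvelope := by
  intro δ hδ hδ'
  have hI2 := intervalIntegral_bump_pow_mem hδ hδ' 2 (by norm_num)
  have hI3 := intervalIntegral_bump_pow_mem hδ hδ' 3 (by norm_num)
  have h32 := intervalIntegral_bump_cube_le_sq hδ hδ'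
  refine ⟨⟨env (bump hδ hδ'), isSmooth_env _, env_mem _ (bump_mem hδ hδ'), fun x hx => env_bump_eq_zero hδ hδ' hx,
    env_integral_sandwich _ hI3.1 h32 hI2.2 hδ'⟩,
    ⟨env (shift (bump hδ hδ') (1 / 2)), isSmooth_env _, env_mem _ (bumpShift_mem hδ hδ'),
      fun x hx => env_bumpShift_eq_zero hδ hδ' hx, ?_⟩⟩
  have e2 := intervalIntegral_pow_shift (bump hδ hδ') (1 / 2) 2
  have e3 := intervalIntegral_pow_shift (bump hδ hδ') (1 / 2) 3
  exact env_integral_sandwich _ (by rw [e3]; exact hI3.1) (by rw [e3, e2]; exact h32) (by rw [e2]; exact hI2.2) hδ'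

end WrapStretching

end Summit.NavierStokesRegularity.FunctionalMining

end
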